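import Summits.QuantumFields.GaugeBoot.SU2LoopPairInversion
import Summits.QuantumFields.GaugeBoot.ZdLoopClasses
import HarnessLib

/-!
# `SU(2)` loop variables of a composite loop read BLOCKWISE BACKWARDS
# (gauge-boot, large-`N` supplement 17, part 6 — the `w ↦ w^R` form of pair inversion)

HONEST FRAMING (cell `pub-gaugeboot`, page 1 of every file): the venture produces certified bounds
on lattice expectations at stated coupling, gauge group, dimension and torus size; NOT a mass gap,
NOT a continuum limit, NOT a string tension; NOT large `N` unless marked CONDITIONAL; NOT
Yang–Mills-summit-bearing (barriers `FixedCouplingUltralocality`, `PerturbativeInvisibility`).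
Lattice combinatorics plus part 2; this file certifies no number.

## Content

For a letter list `ℓ` and based loops `P i`, the composite loop read blockwise backwards,
`subst P ℓ.reverse` (the blocks in reverse ORDER, each block kept as it is), is the REVERSED WORD of
`subst P (invLetters ℓ)` (`Word.reverse_subst_invLetters`, any group, pure list algebra).  Reversal
of a closed word never changes a loop variable (`wordLoop_reverse`: `Re tr ρ(h⁻¹) = Re tr ρ(h)`), so
part 2 gives, for `SU(2)` and two loops:

* ★★★ `wordLoop_subst_reverse` (torus) / `wordLoopZd_subst_reverse` (`ℤ^d`) — **`W_x(w^R(p,q)) =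
  W_x(w(p,q))` as functions of the configuration**, for every word `w` and its blockwise reversal
  `w^R` (e.g. `W(p²qp⁻¹q⁻¹) = W(q⁻¹p⁻¹qp²)`); equal expectations in every state
  (`wilsonExpectation_wordLoop_subst_reverse`).

This is the form `tr w(A,B) = tr w^R(A,B)` of Kapovich–Levitt–Schupp–Shpilrain 2007, Prop. 5.3
(there for `SL(2, K)` via Fricke's trace polynomial), here for the lattice loop variables of `SU(2)`.
For three or more generating loops and for `SU(3)` it fails (parts 1, 5).  [folklore]
-/

noncomputable section

open MeasureTheory
open Literature.MathematicalPhysics.QuantumFieldTheory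
open Literature.MathematicalPhysics.QuantumLattice (LGConfig)

namespace Summit.QuantumFields.GaugeBoot

variable {d : ℕ} {ι : Type*}

/-! ## List algebra: blockwise reversal is the reversed word of the letter-inverted substitution -/

/-- `Word.reverse` is an involution. [folklore] -/
@[simp] theorem Word.reverse_reverse (w : Word d) : Word.reverse (Word.reverse w) = w := by
  simp [Word.reverse, List.map_reverse, List.map_map, Function.comp_def]

/-- The reversed word of one letter block of `invLetters`: `reverse (block (i, !b)) = block (i, b)`. [folklore] -/
theorem Word.reverse_cond_not (p : Word d) (b : Bool) :
    Word.reverse (cond (!b) p (Word.reverse p)) = cond b p (Word.reverse p) := by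
  cases b <;> simp

/-- `subst` of a list with one letter appended. [folklore] -/
theorem Word.subst_append_single (P : ι → Word d) : ∀ (ℓ : List (ι × Bool)) (x : ι × Bool),
    Word.subst P (ℓ ++ [x]) = Word.subst P ℓ ++ cond x.2 (P x.1) (Word.reverse (P x.1))
  | [], x => by simp
  | y :: ℓ, x => by rw [List.cons_append, Word.subst_cons, Word.subst_cons, Word.subst_append_single P ℓ x, List.append_assoc]

/-- ★ **`reverse (subst P (invLetters ℓ)) = subst P ℓ.reverse`**: the composite loop read blockwise
backwards is the reversed word of the letter-inverted composite loop (any `P`, pure list algebra). [folklore] -/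
theorem Word.reverse_subst_invLetters (P : ι → Word d) :
    ∀ ℓ : List (ι × Bool), Word.reverse (Word.subst P (invLetters ℓ)) = Word.subst P ℓ.reverse
  | [] => by simp [invLetters, Word.reverse]
  | (i, b) :: ℓ => by
    have ih := Word.reverse_subst_invLetters P ℓ
    simp only [invLetters, List.map_cons] at ih ⊢
    rw [Word.subst_cons, Word.reverse_append, List.reverse_cons, Word.subst_append_single P, ← ih,
      Word.reverse_cond_not]

/-! ## `SU(2)`, two loops: blockwise reversal is invisible -/

section Torus

variable {L : ℕ}

/-- ★★★ **`W_x(w^R(p,q)) = W_x(w(p,q))` over `SU(2)` (torus), as functions of the configuration**, for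
every letter list `w` and two loops `P 0, P 1` closed at `x`. [folklore] -/
theorem wordLoop_subst_reverse (x : Site d L) (P : Fin 2 → Word d) (hP : ∀ i, Word.endpoint x (P i) = x)
    (ℓ : List (Fin 2 × Bool)) :
    wordLoop (suRep 2) x (Word.subst P ℓ.reverse) = wordLoop (L := L) (suRep 2) x (Word.subst P ℓ) := by
  rw [← Word.reverse_subst_invLetters P ℓ,
    wordLoop_reverse (suRep 2) (continuous_suRep 2) x _ (Word.endpoint_subst x hP (invLetters ℓ)),
    wordLoop_subst_invLetters x P hP ℓ]

/-- Equal expectations in the Wilson state of every torus at every coupling. [folklore] -/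
theorem wilsonExpectation_wordLoop_subst_reverse [NeZero L] (β : ℝ) (x : Site d L) (P : Fin 2 → Word d)
    (hP : ∀ i, Word.endpoint x (P i) = x) (ℓ : List (Fin 2 × Bool)) :
    wilsonExpectation (suRep 2) β (wordLoop (suRep 2) x (Word.subst P ℓ.reverse)) =
      wilsonExpectation (L := L) (suRep 2) β (wordLoop (suRep 2) x (Word.subst P ℓ)) := by
  rw [wordLoop_subst_reverse x P hP ℓ]

end Torus

section Zd

/-- ★★★ **`W_x(w^R(p,q)) = W_x(w(p,q))` over `SU(2)` on `ℤ^d`, as functions of the configuration.** [folklore] -/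
theorem wordLoopZd_subst_reverse (x : Fin d → ℤ) (P : Fin 2 → Word d) (hP : ∀ i, Word.endpointZd x (P i) = x)
    (ℓ : List (Fin 2 × Bool)) :
    wordLoopZd (suRep 2) x (Word.subst P ℓ.reverse) = wordLoopZd (d := d) (suRep 2) x (Word.subst P ℓ) := by
  rw [← Word.reverse_subst_invLetters P ℓ,
    wordLoopZd_reverse (suRep 2) (continuous_suRep 2) x _ (Word.endpointZd_subst x hP (invLetters ℓ)),
    wordLoopZd_subst_invLetters x P hP ℓ]

end Zd

end Summit.QuantumFields.GaugeBoot

end
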